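import Mathlib
import Summits.MatrixMultiplication.Statement
import Summits.MatrixMultiplication.MatrixMultiplication.Theorems.GraphEquationsJetTruncation
import Summits.MatrixMultiplication.MatrixMultiplication.Theorems.GraphEquationsLocalExp

/-!
# Graph equations — EXACT UNIT MEMBERS FORCE THE RANK BOUND (M19i): the last step of every e-rung

The K-ladder engine (M18a–e, `tensorRank_le_of_jet`) reads ISOLATION data and therefore needs a
regularity hypothesis modulo garbage columns and an annihilating left inverse
(`exists_leftInverse_annihilating`).  On the e-ladder the data are EXACT IDENTITIES
`Σ_o h_o^{(q)} · p_o = u_q · f_q` (`u_q(0) ≠ 0`) among the outputs `p_o` of the deflated program —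
and then NO regularity hypothesis and NO left inverse are needed: the matrix
`P_{q,o} = h_o^{(q)}(0) / u_q(0)` of CONSTANT TERMS of the multipliers satisfies both hypotheses of
the osculating core `tensorRank_le_of_oscId` IDENTICALLY, by reading the `c_{q'}`- and the
`a_{ij} b_{j'l}`-coefficients of the exact identities.  The only conditions on the outputs are the
two osculation-flatness conditions at the base point `0`:

  (V0) `p_o(0) = 0`;   (V1) `p_o` has no `(a,b)`-LINEAR terms.

Both hold automatically for members of the graph ideal `I` (`coeff_zero_eq_zero_of_mem_graphIdeal`,
`coeff_single_inl_eq_zero_of_mem_graphIdeal`), and for the derivative outputs `D_ξ ⋯ t` of the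
e-engine they are exactly the affine-kernel-section conditions (NODE-g32 §3, REV 7).

* `coeff_single_one_mul`, `coeff_single_add_single_mul` — Leibniz bookkeeping for coefficients of
  degree `≤ 2` (via `pderiv`; generic `σ`, `R`).
* `tensorRank_le_of_exactMembers` — **THE THEOREM**: outputs `p_o` of nonscalar cost `≤ N` with
  (V0), (V1) and exact unit members `Σ_o h_o^{(q)} p_o = u_q f_q`, `u_q(0) ≠ 0`, for all `q`
  ⇒ `R(⟨n,n,n⟩) ≤ 2N`.
* `EqSystem.Correct.tensorRank_le_of_local_exponent_one` — rung `e = 1` in rank form at ANY base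
  `y` (translation `τ_y` is free): a correct system with `ι(g_q) f_q ∈ J_E`, `g_q(y) ≠ 0`, costs
  `≥ R(⟨n,n,n⟩)/2`;  `omega_le_of_local_exponent_one` — LOCMEM β 1 ⇒ `ω ≤ β` (no `β ≥ 2` needed).

Consequence for the e-LADDER (hand 2 in the local / global exponent currency): rung `e` =
(affine kernel sections with parameters, `e−1` times) + (forward-mode AD, `e−1` times, free) +
(exact Leibniz: `GraphEquationsNullExpMembers`, `GraphEquationsLocalExp`) + THIS THEOREM.  No
residual, no regularity hypothesis, no left inverse.
-/

set_option linter.dupNamespace false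

noncomputable section

open scoped BigOperators

namespace Summit.MatrixMultiplication.MatrixMultiplication.Theorems.GraphEquations

open MvPolynomial
open Literature.Computability.AlgebraicComplexity
open Literature.Computability.AlgebraicComplexity.ArithCircuit

/-! ## Coefficients of degree `≤ 2` of products (Leibniz via `pderiv`) -/

section Coeff

variable {σ R : Type*} [CommSemiring R]

/-- `coeff_{x_v} g = (∂_v g)(0)`. -/
theorem coeff_single_one_eq (v : σ) (g : MvPolynomial σ R) :
    coeff (Finsupp.single v 1) g = coeff 0 (pderiv v g) := by
  rw [coeff_pderiv]; simp

/-- `coeff_{x_v x_w} g = (∂_v ∂_w g)(0)` for `v ≠ w`. -/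
theorem coeff_single_add_single_eq {v w : σ} (hvw : v ≠ w) (g : MvPolynomial σ R) :
    coeff (Finsupp.single v 1 + Finsupp.single w 1) g = coeff 0 (pderiv v (pderiv w g)) := by
  classical
  rw [coeff_pderiv, coeff_pderiv]
  simp [hvw]

/-- `coeff_0 (a b) = coeff_0 a · coeff_0 b`. -/
theorem coeff_zero_mul_eq (a b : MvPolynomial σ R) : coeff 0 (a * b) = coeff 0 a * coeff 0 b := by
  simp [← constantCoeff_eq]

/-- **Leibniz, degree 1:** `coeff_{x_v}(h p) = h(0)·coeff_{x_v} p + coeff_{x_v} h · p(0)`. -/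
theorem coeff_single_one_mul (v : σ) (h p : MvPolynomial σ R) :
    coeff (Finsupp.single v 1) (h * p) =
      coeff 0 h * coeff (Finsupp.single v 1) p + coeff (Finsupp.single v 1) h * coeff 0 p := by
  simp only [coeff_single_one_eq, Derivation.leibniz, smul_eq_mul, coeff_add, coeff_zero_mul_eq]
  ring

/-- **Leibniz, degree 2 (`v ≠ w`):**
`coeff_{x_v x_w}(h p) = h(0)·coeff_{x_v x_w} p + coeff_{x_v} h·coeff_{x_w} p + coeff_{x_w} h·coeff_{x_v} p
+ coeff_{x_v x_w} h · p(0)`. -/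
theorem coeff_single_add_single_mul {v w : σ} (hvw : v ≠ w) (h p : MvPolynomial σ R) :
    coeff (Finsupp.single v 1 + Finsupp.single w 1) (h * p) =
      coeff 0 h * coeff (Finsupp.single v 1 + Finsupp.single w 1) p +
        coeff (Finsupp.single v 1) h * coeff (Finsupp.single w 1) p +
        coeff (Finsupp.single w 1) h * coeff (Finsupp.single v 1) p +
        coeff (Finsupp.single v 1 + Finsupp.single w 1) h * coeff 0 p := by
  simp only [coeff_single_add_single_eq hvw, coeff_single_one_eq, Derivation.leibniz, smul_eq_mul,
    map_add, coeff_add, coeff_zero_mul_eq]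
  ring

end Coeff

variable {n : ℕ}

/-! ## The generator and the graph ideal at the base point `0` -/

/-- `f_q(0) = 0`. -/
theorem coeff_zero_generator (q : Fin n × Fin n) : coeff 0 (generator n q) = 0 := by
  simp [generator, ← constantCoeff_eq, constantCoeff_X]

/-- `f_q` has no `(a,b)`-linear terms. -/
theorem coeff_single_inl_generator (v : MatMulVars n) (q : Fin n × Fin n) :
    coeff (Finsupp.single (Sum.inl v : GraphVars n) 1) (generator n q) = 0 := by
  classical
  rw [coeff_single_one_eq, generator, map_sub, map_sum, coeff_sub, coeff_sum]
  simp only [Derivation.leibniz, pderiv_X, smul_eq_mul, coeff_add, coeff_zero_mul_eq, coeff_zero_X,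
    zero_mul, add_zero, Finset.sum_const_zero, sub_zero]
  simp

/-- `f_q` vanishes on the graph. -/
theorem eval_generator_of_mem {x : GraphVars n → ℂ} (hx : x ∈ mmGraph n) (q : Fin n × Fin n) :
    eval x (generator n q) = 0 := by
  obtain ⟨i, l⟩ := q
  exact eval_generator_eq_zero hx i l

/-- Members of `I` vanish at `0` … -/
theorem coeff_zero_eq_zero_of_mem_graphIdeal {t : MvPolynomial (GraphVars n) ℂ} (ht : t ∈ graphIdeal n) :
    coeff 0 t = 0 := by
  classical
  obtain ⟨g, rfl⟩ := Ideal.mem_span_range_iff_exists_fun.mp ht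
  rw [coeff_sum]
  exact Finset.sum_eq_zero fun q _ => by rw [coeff_zero_mul_eq, coeff_zero_generator, mul_zero]

/-- … and have no `(a,b)`-linear terms. -/
theorem coeff_single_inl_eq_zero_of_mem_graphIdeal {t : MvPolynomial (GraphVars n) ℂ}
    (ht : t ∈ graphIdeal n) (v : MatMulVars n) :
    coeff (Finsupp.single (Sum.inl v : GraphVars n) 1) t = 0 := by
  classical
  obtain ⟨g, rfl⟩ := Ideal.mem_span_range_iff_exists_fun.mp ht
  rw [coeff_sum]
  exact Finset.sum_eq_zero fun q _ => by
    rw [coeff_single_one_mul, coeff_zero_generator, coeff_single_inl_generator, mul_zero, mul_zero,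
      add_zero]

/-! ## The theorem -/

/-- **EXACT UNIT MEMBERS FORCE THE RANK BOUND.**  Let the outputs `p_o` lie in the free span of a
nonscalar sequence of length `≤ N`, vanish at `0` (V0) and have no `(a,b)`-linear terms (V1); suppose
for every position `q` an exact identity `Σ_o h_o^{(q)} p_o = u_q · f_q` with `u_q(0) ≠ 0`.  Then
`R(⟨n,n,n⟩) ≤ 2N`.  (The matrix of the osculating core is `P_{q,o} = h_o^{(q)}(0)/u_q(0)`; its two
hypotheses are the `c_{q'}`- and `a_{ij}b_{j'l}`-coefficients of the identities.) -/
theorem tensorRank_le_of_exactMembers {N : ℕ} {ο : Type*} [Fintype ο] [DecidableEq ο]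
    (p : ο → MvPolynomial (GraphVars n) ℂ)
    (hspan : ∃ gs : List (MvPolynomial (GraphVars n) ℂ), IsNonscalarSeq gs ∧ gs.length ≤ N ∧
      ∀ o, p o ∈ freeSpan {q | q ∈ gs})
    (h0 : ∀ o, coeff 0 (p o) = 0)
    (h1 : ∀ o (v : MatMulVars n), coeff (Finsupp.single (Sum.inl v : GraphVars n) 1) (p o) = 0)
    (h : Fin n × Fin n → ο → MvPolynomial (GraphVars n) ℂ)
    (u : Fin n × Fin n → MvPolynomial (GraphVars n) ℂ) (hu : ∀ q, coeff 0 (u q) ≠ 0)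
    (hmem : ∀ q, ∑ o, h q o * p o = u q * generator n q) :
    tensorRank (matMulTensor ℂ n n n) ≤ 2 * N := by
  classical
  -- (1) the `c_{q'}`-coefficients of the identities
  have hc : ∀ q q' : Fin n × Fin n,
      ∑ o, coeff 0 (h q o) * coeff (Finsupp.single (Sum.inr q' : GraphVars n) 1) (p o) =
        coeff 0 (u q) * (if q = q' then 1 else 0) := by
    intro q q'
    have := congrArg (coeff (Finsupp.single (Sum.inr q' : GraphVars n) 1)) (hmem q)
    simpa only [coeff_sum, coeff_single_one_mul, h0, mul_zero, add_zero, coeff_zero_generator,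
      coeff_inr_generator] using this
  -- (2) the `a_{ij} b_{j'l}`-coefficients of the identities
  have hab : ∀ (q : Fin n × Fin n) (i j j' l : Fin n),
      ∑ o, coeff 0 (h q o) * coeff (Finsupp.single (Sum.inl (Sum.inl (i, j)) : GraphVars n) 1 +
          Finsupp.single (Sum.inl (Sum.inr (j', l)) : GraphVars n) 1) (p o) =
        coeff 0 (u q) * -(if j = j' then
          coeff (Finsupp.single (Sum.inr (i, l) : GraphVars n) 1) (generator n q) else 0) := by
    intro q i j j' l
    have hvw : (Sum.inl (Sum.inl (i, j)) : GraphVars n) ≠ Sum.inl (Sum.inr (j', l)) := by simp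
    have := congrArg (coeff (Finsupp.single (Sum.inl (Sum.inl (i, j)) : GraphVars n) 1 +
      Finsupp.single (Sum.inl (Sum.inr (j', l)) : GraphVars n) 1)) (hmem q)
    simpa only [coeff_sum, coeff_single_add_single_mul hvw, h0, h1, mul_zero, add_zero,
      coeff_zero_generator, coeff_single_inl_generator,
      coeffIdentity n (generator n q) (fun x hx => eval_generator_of_mem hx q) i j j' l] using this
  -- (3) the osculating core with the explicit matrix `P` and the tautological error term
  let cab : (Fin n × Fin n) × (Fin n × Fin n) → (GraphVars n →₀ ℕ) := fun r =>
    Finsupp.single (Sum.inl (Sum.inl r.1) : GraphVars n) 1 + Finsupp.single (Sum.inl (Sum.inr r.2)) 1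
  let H : ο → (Fin n × Fin n) × (Fin n × Fin n) → ℂ := fun o r =>
    -(coeff (cab r) (p o) +
      if r.1.2 = r.2.1 then coeff (Finsupp.single (Sum.inr (r.1.1, r.2.2) : GraphVars n) 1) (p o) else 0)
  let M : (Fin n × Fin n) × (Fin n × Fin n) → Fin n × Fin n → Fin n × Fin n → ℂ := fun r a b =>
    if r = (a, b) then 1 else 0
  let P : Fin n × Fin n → ο → ℂ := fun c o => coeff 0 (h c o) / coeff 0 (u c)
  refine tensorRank_le_of_oscId p hspan H M (fun o i j j' l => ?_) P (fun c q => ?_) (fun c r => ?_)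
  · have hsum : ∑ r, H o r * M r (i, j) (j', l) = H o ((i, j), (j', l)) := by
      simp only [M, mul_ite, mul_one, mul_zero, Finset.sum_ite_eq', Finset.mem_univ, if_true]
    rw [hsum]
    simp only [H, cab]
    ring
  · have hdiv : ∑ o, P c o * coeff (Finsupp.single (Sum.inr q : GraphVars n) 1) (p o) =
        (∑ o, coeff 0 (h c o) * coeff (Finsupp.single (Sum.inr q : GraphVars n) 1) (p o)) /
          coeff 0 (u c) := by
      rw [Finset.sum_div]
      exact Finset.sum_congr rfl fun o _ => by simp only [P]; ring
    rw [hdiv, hc, mul_div_cancel_left₀ _ (hu c)]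
  · obtain ⟨⟨i, j⟩, ⟨j', l⟩⟩ := r
    have key : ∑ o, coeff 0 (h c o) * H o ((i, j), (j', l)) = 0 := by
      by_cases hjj : j = j'
      · subst hjj
        simp only [H, cab, if_true, mul_neg, mul_add, Finset.sum_neg_distrib,
          Finset.sum_add_distrib, hab, hc, coeff_inr_generator, neg_eq_zero]
        ring
      · simp only [H, cab, hjj, if_false, add_zero, mul_neg, Finset.sum_neg_distrib, hab, mul_zero,
          neg_zero, mul_neg]
    have hdiv : ∑ o, P c o * H o ((i, j), (j', l)) =
        (∑ o, coeff 0 (h c o) * H o ((i, j), (j', l))) / coeff 0 (u c) := by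
      rw [Finset.sum_div]
      exact Finset.sum_congr rfl fun o _ => by simp only [P]; ring
    rw [hdiv, key, zero_div]

/-! ## Rung `e = 1` in rank form, at any base -/

/-- `coeff 0 (τ_y g) = g(y)`. -/
theorem coeff_zero_shiftAB (y : MatMulVars n → ℂ) (g : MvPolynomial (MatMulVars n) ℂ) :
    coeff 0 (shiftAB y g) = eval y g := by
  show constantCoeff (shiftAB y g) = eval y g
  induction g using MvPolynomial.induction_on with
  | C a => simp
  | add p q hp hq => simp [hp, hq]
  | mul_X p v hp => simp [hp, constantCoeff_X]

/-- **Local membership exponent `1` at a base `y` ⇒ `R(⟨n,n,n⟩) ≤ 2·cost`** (the rung-`1` instance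
of `tensorRank_le_of_exactMembers`: outputs = the translated tests, members = the translated
identities `ι(g_q) f_q = Σ_o k_o t_o`; the translation `τ_y` fixes every `f_q` and is free). -/
theorem EqSystem.Correct.tensorRank_le_of_local_exponent_one {E : EqSystem n} (hE : E.Correct)
    (y : MatMulVars n → ℂ)
    (h : ∀ q : Fin n × Fin n, ∃ g : MvPolynomial (MatMulVars n) ℂ, eval y g ≠ 0 ∧
      liftAB n g * generator n q ∈
        Ideal.span (Set.range fun o : Fin E.tests.length => E.testPoly (E.tests.get o))) :
    tensorRank (matMulTensor ℂ n n n) ≤ 2 * E.cost := by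
  classical
  choose g hg hmem using h
  have hcomb : ∀ q, ∃ k : Fin E.tests.length → MvPolynomial (GraphVars n) ℂ,
      ∑ o, k o * E.testPoly (E.tests.get o) = liftAB n (g q) * generator n q :=
    fun q => Ideal.mem_span_range_iff_exists_fun.mp (hmem q)
  choose k hk using hcomb
  obtain ⟨gs, hns, hlen, hfs⟩ := exists_isNonscalarSeq_translate hE.1 y
  have hpI : ∀ o : Fin E.tests.length, translate y (E.testPoly (E.tests.get o)) ∈ graphIdeal n :=
    fun o => translate_mem_graphIdeal y
      (mem_graphIdeal_of_vanishing fun x hx => hE.eval_testPoly_eq_zero hx (List.get_mem _ _))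
  refine tensorRank_le_of_exactMembers (fun o => translate y (E.testPoly (E.tests.get o)))
    ⟨gs, hns, hlen, hfs⟩ (fun o => coeff_zero_eq_zero_of_mem_graphIdeal (hpI o))
    (fun o v => coeff_single_inl_eq_zero_of_mem_graphIdeal (hpI o) v)
    (fun q o => translate y (k q o)) (fun q => liftAB n (shiftAB y (g q))) (fun q => ?_) (fun q => ?_)
  · rw [coeff_zero_liftAB, coeff_zero_shiftAB]; exact hg q
  · have := congrArg (translate y) (hk q)
    simpa only [translate_eq, map_sum, map_mul, bind₁_shift_liftAB,
      bind₁_shift_generator (graphPoint_mem_mmGraph y)] using this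

/-- **LOCMEM β 1 ⇒ `ω ≤ β`** (any real `β`): cost-`c·n^β` correct families with local membership
exponent `1` at some base bound `ω` — rung `e = 1` of the e-ladder as a RANK statement. -/
theorem omega_le_of_local_exponent_one {β : ℝ}
    (h : ∃ c : ℝ, ∀ n : ℕ, 1 ≤ n → ∃ E : EqSystem n, E.Correct ∧
      (∃ y : MatMulVars n → ℂ, ∀ q : Fin n × Fin n, ∃ g : MvPolynomial (MatMulVars n) ℂ, eval y g ≠ 0 ∧
        liftAB n g * generator n q ∈
          Ideal.span (Set.range fun o : Fin E.tests.length => E.testPoly (E.tests.get o))) ∧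
      (E.cost : ℝ) ≤ c * (n : ℝ) ^ β) :
    omega ℂ ≤ β := by
  obtain ⟨c, hc⟩ := h
  have hmem : β ∈ admissibleExponents ℂ := by
    change (fun n : ℕ => (tensorRank (matMulTensor ℂ n n n) : ℝ)) =O[Filter.atTop]
      fun n : ℕ => (n : ℝ) ^ β
    refine Asymptotics.IsBigO.of_bound (2 * |c|) ?_
    filter_upwards [Filter.eventually_ge_atTop 1] with n hn
    obtain ⟨E, hE, ⟨y, hy⟩, hcost⟩ := hc n hn
    have h1 := hE.tensorRank_le_of_local_exponent_one y hy
    rw [Real.norm_of_nonneg (Nat.cast_nonneg _),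
      Real.norm_of_nonneg (Real.rpow_nonneg (Nat.cast_nonneg _) _)]
    have h3 : (tensorRank (matMulTensor ℂ n n n) : ℝ) ≤ 2 * (E.cost : ℝ) := by
      exact_mod_cast h1
    have h4 : c * (n : ℝ) ^ β ≤ |c| * (n : ℝ) ^ β := by
      gcongr; exact le_abs_self c
    nlinarith [h3, hcost, h4, Real.rpow_nonneg (Nat.cast_nonneg n) β]
  exact csInf_le (admissibleExponents_bddBelow ℂ) hmem

end Summit.MatrixMultiplication.MatrixMultiplication.Theorems.GraphEquations

end
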